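import Summits.BirchSwinnertonDyer.BirchSwinnertonDyer.Theorems.ManinLocalTwoThreeKummerCubeRootThreeBounded
import Mathlib.Algebra.QuadraticAlgebra.Basic
import HarnessLib

/-!
# (INT)_K, components: a cube root over `K = ℚ(Y)`, `[K:ℚ] = 2`, and its conjugate
(route `ManinLocalTwoThree`, crux C3 `ManinPrimeToThreeAtNine` stmt-BirchSwinnertonDyer-22968; cell bsd-f2-manin, prover seat p3 gen 16 —
piece (INT)_K of -an g39's `K`-rational UDC line, p2 g18's interface; `--supports` 22968)

For `Y ∈ ℂ ∖ ℚ` with `Y² = r ∈ ℚ` and `Θ = Θ' + Y·Θ''` (`Θ', Θ'' ∈ ℚ⟦X⟧`, `Θ(0) = −1`), the normalised cube root `h` of `Θ` in `ℂ⟦X⟧`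
(`h³ = Θ`, `h(0) = −1`) has COMPONENTS: `h = u + Y·v` with `u, v ∈ ℚ⟦X⟧`, the conjugate `u − Y·v` is the normalised cube root of
`Θ' − Y·Θ''`, and integrality statements `m·hₙ ∈ ℤ̄` pass to the conjugate `m·(uₙ − Y vₙ) ∈ ℤ̄`.  Mechanism: the cube root is built
over the quadratic algebra `K₀ = ℚ[ω]/(ω² = r)` (binomial series) and pushed to `ℂ` along the two lifts `ω ↦ ±Y` (injective since
`Y ∉ ℚ`); uniqueness of normalised cube roots in `ℂ⟦X⟧` (`cubeRoot_unique`).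

* `exists_cubeRoot_of_constantCoeff_eq_neg_one'` — cube roots with constant term `−1` exist over any commutative `ℚ`-algebra.
* `eq_zero_of_ratCast_add_mul_eq_zero` — `ℚ`-linear independence of `1, Y`.
* `exists_components` — the statement above.

HONEST FRAMING.  Pure algebra; nothing about (INT)_K's integrality conclusion, C3, Manin's conjecture or BSD is proved here.
No definitions, no sorry. [folklore]
-/

set_option autoImplicit false
-- lint-debt: the directory name repeats the summit name (sibling precedent `ManinLocalTwoThreeKummerCubeRootThreeBounded.lean`)
set_option linter.dupNamespace false

noncomputable section

open scoped Classical QuadraticAlgebra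
open PowerSeries

namespace Summit.BirchSwinnertonDyer.BirchSwinnertonDyer.Theorems.ManinLocalTwoThree.CubeRootComponents

open Summit.BirchSwinnertonDyer.BirchSwinnertonDyer.Theorems.ManinLocalTwoThree.KummerCubeRootBounded (cubeRoot_unique)

/-! ## §1 Cube roots over a commutative `ℚ`-algebra -/

/-- **A cube root with constant term `−1` exists over any commutative `ℚ`-algebra** (`h = −(1 + Y)^{1/3}`, `Y = −(Θ + 1)`, binomial series).
[folklore] -/
theorem exists_cubeRoot_of_constantCoeff_eq_neg_one' {A : Type*} [CommRing A] [Algebra ℚ A] (Θ : A⟦X⟧) (hΘ : constantCoeff Θ = -1) :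
    ∃ h : A⟦X⟧, h ^ 3 = Θ ∧ constantCoeff h = -1 := by
  set Y : A⟦X⟧ := -(Θ + 1) with hY
  have hY0 : constantCoeff Y = 0 := by rw [hY, map_neg, map_add, hΘ, map_one]; ring
  have hYs : HasSubst Y := HasSubst.of_constantCoeff_zero' hY0
  set g : A⟦X⟧ := (PowerSeries.binomialSeries A (1 / 3 : ℚ)).subst Y with hg
  have hcube : PowerSeries.binomialSeries A (1 / 3 : ℚ) ^ 3 = 1 + X := by
    have h13 : (1 : ℚ) = 1 / 3 + 1 / 3 + 1 / 3 := by norm_num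
    have h := PowerSeries.binomialSeries_nat (R := ℚ) (A := A) 1
    rw [Nat.cast_one, pow_one, h13, PowerSeries.binomialSeries_add, PowerSeries.binomialSeries_add] at h
    rw [← h]; ring
  have hg3 : g ^ 3 = 1 + Y := by
    rw [hg, ← coe_substAlgHom hYs, ← map_pow, hcube, map_add, map_one, coe_substAlgHom hYs, subst_X hYs]
  have hg0 : constantCoeff g = 1 := by
    rw [hg, Literature.RingTheory.FormalGroups.constantCoeff_subst_of_constantCoeff_eq_zero hY0, PowerSeries.binomialSeries_constantCoeff]
  refine ⟨-g, ?_, ?_⟩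
  · rw [neg_pow, hg3, hY]; ring
  · rw [map_neg, hg0]

/-! ## §2 `ℚ`-linear independence of `1, Y` -/

/-- If `Y ∉ ℚ` then `a + bY = 0` with `a, b ∈ ℚ` forces `a = b = 0`. [folklore] -/
theorem eq_zero_of_ratCast_add_mul_eq_zero {Y : ℂ} (hY : ∀ q : ℚ, (q : ℂ) ≠ Y) {a b : ℚ} (h : (a : ℂ) + b * Y = 0) :
    a = 0 ∧ b = 0 := by
  by_cases hb : b = 0
  · subst hb
    simp only [Rat.cast_zero, zero_mul, add_zero, Rat.cast_eq_zero] at h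
    exact ⟨h, rfl⟩
  · exfalso
    refine hY (-a / b) ?_
    have hb' : (b : ℂ) ≠ 0 := by exact_mod_cast hb
    push_cast
    field_simp
    linear_combination -h

/-- Series version: `map a + C Y · map b = map a' + C Y · map b'` forces `a = a'`, `b = b'`. [folklore] -/
theorem map_add_C_mul_map_injective {Y : ℂ} (hY : ∀ q : ℚ, (q : ℂ) ≠ Y) {a b a' b' : ℚ⟦X⟧}
    (h : PowerSeries.map (algebraMap ℚ ℂ) a + C Y * PowerSeries.map (algebraMap ℚ ℂ) b =
      PowerSeries.map (algebraMap ℚ ℂ) a' + C Y * PowerSeries.map (algebraMap ℚ ℂ) b') : a = a' ∧ b = b' := by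
  have key : ∀ n, coeff n a = coeff n a' ∧ coeff n b = coeff n b' := fun n ↦ by
    have hn := congrArg (coeff n) h
    simp only [map_add, coeff_map, coeff_C_mul, eq_ratCast] at hn
    have h0 : ((coeff n a - coeff n a' : ℚ) : ℂ) + (coeff n b - coeff n b' : ℚ) * Y = 0 := by
      push_cast; linear_combination hn
    obtain ⟨h1, h2⟩ := eq_zero_of_ratCast_add_mul_eq_zero hY h0
    exact ⟨sub_eq_zero.mp h1, sub_eq_zero.mp h2⟩
  exact ⟨PowerSeries.ext fun n ↦ (key n).1, PowerSeries.ext fun n ↦ (key n).2⟩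

/-! ## §3 The quadratic algebra `K₀ = ℚ[ω]/(ω² = r)` and its two embeddings `ω ↦ ±Y` -/

section Quadratic

variable {Y : ℂ} {r : ℚ} (hr : Y ^ 2 = (r : ℂ))
include hr

/-- The root conditions for the two lifts `ω ↦ ±Y`. [folklore] -/
theorem lift_cond (s : ℂ) (hs : s = Y ∨ s = -Y) : s * s = r • (1 : ℂ) + (0 : ℚ) • s := by
  rw [Rat.smul_one_eq_cast, zero_smul, add_zero, ← sq]
  rcases hs with rfl | rfl
  · exact hr
  · rw [neg_sq]; exact hr

/-- The lift `ω ↦ s` (`s = ±Y`) sends `⟨x, y⟩` to `x + y·s`. [folklore] -/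
theorem lift_apply_eq (s : ℂ) (hs : s = Y ∨ s = -Y) (x : QuadraticAlgebra ℚ r 0) :
    QuadraticAlgebra.lift ⟨s, lift_cond hr s hs⟩ x = (x.re : ℂ) + (x.im : ℂ) * s := by
  rw [QuadraticAlgebra.lift_apply_apply, Rat.smul_one_eq_cast, Rat.smul_def]

/-- The lift `ω ↦ s` (`s = ±Y`) is injective when `Y ∉ ℚ`. [folklore] -/
theorem lift_injective (hY : ∀ q : ℚ, (q : ℂ) ≠ Y) (s : ℂ) (hs : s = Y ∨ s = -Y) :
    Function.Injective (QuadraticAlgebra.lift ⟨s, lift_cond hr s hs⟩ : QuadraticAlgebra ℚ r 0 →ₐ[ℚ] ℂ) := by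
  intro x y hxy
  rw [lift_apply_eq hr s hs, lift_apply_eq hr s hs] at hxy
  have hs' : ∃ ε : ℚ, (ε = 1 ∨ ε = -1) ∧ s = (ε : ℂ) * Y := by
    rcases hs with rfl | rfl
    · exact ⟨1, Or.inl rfl, by simp⟩
    · exact ⟨-1, Or.inr rfl, by simp⟩
  obtain ⟨ε, hε, hsε⟩ := hs'
  have hε0 : ε ≠ 0 := by rcases hε with rfl | rfl <;> norm_num
  have h0 : ((x.re - y.re : ℚ) : ℂ) + ((x.im - y.im) * ε : ℚ) * Y = 0 := by
    push_cast; rw [hsε] at hxy; linear_combination hxy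
  obtain ⟨h1, h2⟩ := eq_zero_of_ratCast_add_mul_eq_zero hY h0
  ext
  · exact sub_eq_zero.mp h1
  · exact sub_eq_zero.mp ((mul_eq_zero.mp h2).resolve_right hε0)

/-- Mapping a series over `K₀` along the lift `ω ↦ s`: coefficientwise `re + im·s`, i.e. `map re + C s · map im` (as `ℚ`-series). [folklore] -/
theorem map_lift_eq (s : ℂ) (hs : s = Y ∨ s = -Y) (F : (QuadraticAlgebra ℚ r 0)⟦X⟧) :
    PowerSeries.map ((QuadraticAlgebra.lift ⟨s, lift_cond hr s hs⟩ : QuadraticAlgebra ℚ r 0 →ₐ[ℚ] ℂ) : QuadraticAlgebra ℚ r 0 →+* ℂ) F =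
      PowerSeries.map (algebraMap ℚ ℂ) (PowerSeries.mk fun n ↦ (coeff n F).re)
        + C s * PowerSeries.map (algebraMap ℚ ℂ) (PowerSeries.mk fun n ↦ (coeff n F).im) := by
  ext n
  simp only [coeff_map, map_add, coeff_C_mul, coeff_mk, eq_ratCast, RingHom.coe_coe]
  rw [lift_apply_eq hr s hs]; ring

end Quadratic

/-! ## §4 Components of the cube root and of its conjugate -/

/-- **Components.**  `Y ∉ ℚ`, `Y² = r ∈ ℚ`, `Θ', Θ'' ∈ ℚ⟦X⟧` with `Θ'(0) = −1`, `Θ''(0) = 0`, and `h ∈ ℂ⟦X⟧` with `h³ = Θ' + Y·Θ''`, `h(0) = −1`.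
Then `h = u + Y·v` (`u, v ∈ ℚ⟦X⟧`), `(u − Y·v)³ = Θ' − Y·Θ''`, and for every `n` and `m ∈ ℤ`: `m·hₙ ∈ ℤ̄ ⟹ m·(uₙ − Y vₙ) ∈ ℤ̄`.
[folklore] -/
theorem exists_components {Y : ℂ} (hY : ∀ q : ℚ, (q : ℂ) ≠ Y) {r : ℚ} (hr : Y ^ 2 = (r : ℂ)) (Θ' Θ'' : ℚ⟦X⟧)
    (hΘ' : constantCoeff Θ' = -1) (hΘ'' : constantCoeff Θ'' = 0) (h : ℂ⟦X⟧)
    (hh3 : h ^ 3 = PowerSeries.map (algebraMap ℚ ℂ) Θ' + C Y * PowerSeries.map (algebraMap ℚ ℂ) Θ'') (hh0 : constantCoeff h = -1) :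
    ∃ u v : ℚ⟦X⟧, h = PowerSeries.map (algebraMap ℚ ℂ) u + C Y * PowerSeries.map (algebraMap ℚ ℂ) v ∧
      (PowerSeries.map (algebraMap ℚ ℂ) u - C Y * PowerSeries.map (algebraMap ℚ ℂ) v) ^ 3 =
        PowerSeries.map (algebraMap ℚ ℂ) Θ' - C Y * PowerSeries.map (algebraMap ℚ ℂ) Θ'' ∧
      ∀ (n : ℕ) (m : ℤ), IsIntegral ℤ ((m : ℂ) * coeff n h) → IsIntegral ℤ ((m : ℂ) * (((coeff n u : ℚ) : ℂ) - Y * ((coeff n v : ℚ) : ℂ))) := by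
  -- the cube root over `K₀`
  set K₀ := QuadraticAlgebra ℚ r 0
  set ι : ℚ →+* K₀ := algebraMap ℚ K₀ with hι
  set ΘK : K₀⟦X⟧ := PowerSeries.map ι Θ' + C (ω : K₀) * PowerSeries.map ι Θ'' with hΘK
  have h1 : coeff 0 Θ' = -1 := by rw [coeff_zero_eq_constantCoeff_apply, hΘ']
  have h2 : coeff 0 Θ'' = 0 := by rw [coeff_zero_eq_constantCoeff_apply, hΘ'']
  have hΘK0 : constantCoeff ΘK = -1 := by
    rw [← coeff_zero_eq_constantCoeff_apply, hΘK, map_add, coeff_map, h1, coeff_C_mul, coeff_map, h2, map_zero, mul_zero, add_zero,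
      map_neg, map_one]
  obtain ⟨hK, hK3, hK0⟩ := exists_cubeRoot_of_constantCoeff_eq_neg_one' ΘK hΘK0
  -- the two lifts
  set φp : K₀ →ₐ[ℚ] ℂ := QuadraticAlgebra.lift ⟨Y, lift_cond hr Y (Or.inl rfl)⟩ with hφp
  set φm : K₀ →ₐ[ℚ] ℂ := QuadraticAlgebra.lift ⟨-Y, lift_cond hr (-Y) (Or.inr rfl)⟩ with hφm
  have hφpω : φp ω = Y := by rw [hφp, lift_apply_eq hr Y (Or.inl rfl)]; simp
  have hφmω : φm ω = -Y := by rw [hφm, lift_apply_eq hr (-Y) (Or.inr rfl)]; simp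
  have hmapι : ∀ (ψ : K₀ →ₐ[ℚ] ℂ) (G : ℚ⟦X⟧), PowerSeries.map (ψ : K₀ →+* ℂ) (PowerSeries.map ι G) = PowerSeries.map (algebraMap ℚ ℂ) G :=
    fun ψ G ↦ by ext n; simp [coeff_map, hι]
  have hΘp : PowerSeries.map (φp : K₀ →+* ℂ) ΘK = PowerSeries.map (algebraMap ℚ ℂ) Θ' + C Y * PowerSeries.map (algebraMap ℚ ℂ) Θ'' := by
    rw [hΘK, map_add, map_mul, PowerSeries.map_C, hmapι, hmapι, RingHom.coe_coe, hφpω]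
  have hΘm : PowerSeries.map (φm : K₀ →+* ℂ) ΘK = PowerSeries.map (algebraMap ℚ ℂ) Θ' - C Y * PowerSeries.map (algebraMap ℚ ℂ) Θ'' := by
    rw [hΘK, map_add, map_mul, PowerSeries.map_C, hmapι, hmapι, RingHom.coe_coe, hφmω, map_neg, neg_mul, ← sub_eq_add_neg]
  set u : ℚ⟦X⟧ := PowerSeries.mk fun n ↦ (coeff n hK).re with hu
  set v : ℚ⟦X⟧ := PowerSeries.mk fun n ↦ (coeff n hK).im with hv
  have hpu : PowerSeries.map (φp : K₀ →+* ℂ) hK = PowerSeries.map (algebraMap ℚ ℂ) u + C Y * PowerSeries.map (algebraMap ℚ ℂ) v :=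
    map_lift_eq hr Y (Or.inl rfl) hK
  have hmu : PowerSeries.map (φm : K₀ →+* ℂ) hK = PowerSeries.map (algebraMap ℚ ℂ) u - C Y * PowerSeries.map (algebraMap ℚ ℂ) v := by
    rw [map_lift_eq hr (-Y) (Or.inr rfl) hK, map_neg, neg_mul, ← sub_eq_add_neg]
  -- `h = φp(hK)` by uniqueness of normalised cube roots in `ℂ⟦X⟧`
  have h3p : (PowerSeries.map (φp : K₀ →+* ℂ) hK) ^ 3 = h ^ 3 := by rw [← map_pow, hK3, hΘp, hh3]
  have hK0' : coeff 0 hK = -1 := by rw [coeff_zero_eq_constantCoeff_apply, hK0]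
  have h0p : constantCoeff (PowerSeries.map (φp : K₀ →+* ℂ) hK) = constantCoeff h := by
    rw [← coeff_zero_eq_constantCoeff_apply, coeff_map, hK0', map_neg, map_one, hh0]
  have heq : PowerSeries.map (φp : K₀ →+* ℂ) hK = h :=
    cubeRoot_unique (by norm_num) h3p h0p (by rw [h0p, hh0]; norm_num)
  refine ⟨u, v, by rw [← hpu, heq], by rw [← hmu, ← map_pow, hK3, hΘm], fun n m hint ↦ ?_⟩
  -- integrality passes to the conjugate via `φm ∘ φp⁻¹`
  have hinj := lift_injective hr hY Y (Or.inl rfl)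
  have hcoef : (m : ℂ) * coeff n h = φp ((m : K₀) * coeff n hK) := by
    rw [← heq, coeff_map, map_mul, map_intCast, RingHom.coe_coe]
  rw [hcoef] at hint
  have hint' : IsIntegral ℤ ((m : K₀) * coeff n hK) := (isIntegral_algHom_iff (φp.toRingHom.toIntAlgHom) hinj).mp hint
  have himg := hint'.map (φm.toRingHom.toIntAlgHom)
  have hφmx : φm (coeff n hK) = ((coeff n u : ℚ) : ℂ) - Y * ((coeff n v : ℚ) : ℂ) := by
    rw [hφm, lift_apply_eq hr (-Y) (Or.inr rfl), hu, hv, coeff_mk, coeff_mk]; ring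
  have hm : φm (m : K₀) = (m : ℂ) := map_intCast φm m
  simpa [hφmx, hm] using himg

end Summit.BirchSwinnertonDyer.BirchSwinnertonDyer.Theorems.ManinLocalTwoThree.CubeRootComponents

end
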